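import Mathlib
import Literature.Analysis.ValidatedNumerics.FixedPointInterval

/-!
# Crux `NashNearField` (16827), stub `stub_triLandscapeFar`: the certified-numerics kernel I —
# computable centred-form lower bounds for sums of Lennard-Jones terms over a box, and the term tables

The finite truncation `W_{K,F}(t; a, h)` of the word-free layer excess (`stub_triTruncation`) is, for a fixed
offset word and a fixed clip case of the reference cell, a signed sum `G(t) = Σ_i w_i φ(q_i(t))` of terms
`φ(q) = q⁻⁶/12 − q⁻³/6 = V_LJ(√q)` (`tri_lj_sqrt_eq`) at squared distances that are NON-NEGATIVE QUADRATIC FORMS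
of the six gauge parameters `t = (t₀₀, t₀₁, t₀₂, t₁₁, t₁₂, t₂₂)`: `q_i(t) = Σ_r κ_{ir} ℓ_{ir}(t)²`, `κ_{ir} ≥ 0`,
`ℓ_{ir}` affine (deformed terms: `(t₀₀X + t₀₁Y + t₀₂Z)² + (t₁₁Y + t₁₂Z)² + (t₂₂Z)²`, weight `+1` or `+½`;
reference terms: `Q·a(t)² + (2s²/3)·t₂₂²` etc., weight `−1` or `−½`).  PART A of this file is the COMPUTABLE
kernel that bounds such a `G` from below on a box `|t_k − c_k| ≤ e_k` by a CENTRED FORM with a convexity-aware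
interval-Hessian remainder,

`G(t) ≥ G(c) + ∇G(c)·(t − c) − ½ Σ_{k,l} e_k e_l (|M|_{kl} + |N|_{kl})`,

`M ∋ Σ_i m_i ∂_k q_i(ξ) ∂_l q_i(ξ)` (uniformly in `ξ` in the box), `N ∋ Σ_i n_i ∂²_{kl} q_i`, with only the NEGATIVE
parts `m_i = (w_i φ''|_box)₋`, `n_i = (w_i φ'(q_i(c)))₋` of the two pieces of the Hessian `w_i(φ''∇q∇qᵀ + φ'∇²q)`
(both rank-one/PSD up to sign, so positive parts are dropped for a LOWER bound), followed by the linear minimisation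
of `∇G(c)·(t − c)` over the box intersected with linear constraints through supplied non-negative multipliers
(weak duality).  PART B: the term tables — enclosures `SQRT3`, `SQRT6`; the deformed term `dTerm i j δ s w`; the
reference term `rTerm i j δ s w ac hc` in each clip case (`a = 47/50 ∣ (t₀₀ + t₁₁)/2 ∣ 1`, `h = 39a/50 ∣ (√6/3) t₂₂ ∣ 17a/20`);
the index lists `layerPts` of a layer inside the template ball; group builders `dGroup`/`rGroup`.  Everything is
fixed-point interval arithmetic on `ℤ` at scale `2^48` (`Literature.Analysis.ValidatedNumerics.Numerics.FI`),
kernel/`native_decide`-evaluable, mirrored bit for bit by the certificate generator (`farkernel.py` on the item).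
Semantics and soundness: `…FarSemantics`, `…FarSoundRows`, `…FarSoundAccum`, `…FarSoundCalculus`, `…FarSoundStep`,
`…FarSoundFinal` (main theorem `Far.lowerBound_sound`).  Nothing is asserted in this file.
-/

namespace Summit.AtomisticToContinuum.Crystallization.Theorems.NashClassCertificatesNashNearField

namespace Far


open Literature.Analysis.ValidatedNumerics.Numerics

/-! ### Small additions to the interval arithmetic -/

/-- The point interval `0`. [folklore] -/
def fiZero : FI := ⟨0, 0⟩

/-- Enclosure of a rational. [folklore] -/
def fiOfRat (q : ℚ) : FI := FI.ofFrac q.num q.den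

/-- `I · q` for a rational `q` (exact sign handling by `mulInt`, outward rounding by `divNat`). [folklore] -/
def fiScale (I : FI) (q : ℚ) : FI := (I.mulInt q.num).divNat q.den

/-- Tight square: `[lo², hi²]`, `[hi², lo²]` or `[0, max²]` according to the sign pattern. [folklore] -/
def fiSqr (I : FI) : FI :=
  if 0 ≤ I.lo then ⟨I.lo * I.lo / SC, cdiv (I.hi * I.hi) SC⟩
  else if I.hi ≤ 0 then ⟨I.hi * I.hi / SC, cdiv (I.lo * I.lo) SC⟩
  else ⟨0, cdiv (max (I.lo * I.lo) (I.hi * I.hi)) SC⟩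

/-- `I ^ n` by repeated (Moore) multiplication. [folklore] -/
def fiPow (I : FI) : ℕ → FI
  | 0 => FI.ofInt 1
  | n + 1 => FI.mul (fiPow I n) I

/-- The point interval at the lower end. [folklore] -/
def fiLoPt (I : FI) : FI := ⟨I.lo, I.lo⟩

/-- The point interval at the upper end. [folklore] -/
def fiHiPt (I : FI) : FI := ⟨I.hi, I.hi⟩

/-- Entry `k` of a list of intervals (`0` beyond the end). [folklore] -/
def getFI (v : List FI) (k : ℕ) : FI := v.getD k fiZero

/-- Add `x` to entry `k` of a list of intervals (no-op beyond the end). [folklore] -/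
def addAt : List FI → ℕ → FI → List FI
  | [], _, _ => []
  | a :: v, 0, x => FI.add a x :: v
  | a :: v, k + 1, x => a :: addAt v k x

/-- The list of `n` zero intervals. [folklore] -/
def zeros (n : ℕ) : List FI := List.replicate n fiZero

/-! ### Terms, boxes, constraints -/

/-- One affine row `ℓ(t) = Σ_{(k, α)} α t_k + const` with interval coefficients and its weight `κ ≥ 0`
in the quadratic form. [folklore] -/
structure CRow where
  /-- weight of `ℓ²` in `q` (meant to be `≥ 0`) -/
  κ : ℚ
  /-- sparse coefficients `(variable index, enclosure of the real coefficient)` -/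
  coef : List (ℕ × FI)
  /-- enclosure of the constant coefficient -/
  const : FI

/-- One term `w · φ(Σ_r κ_r ℓ_r(t)²)`. [folklore] -/
structure CTerm where
  /-- signed weight (`±1`, `±1/2`) -/
  w : ℚ
  /-- the rows of the quadratic form -/
  rows : List CRow

/-- A box in centre/half-width form at scale `2^48`: `centre` encloses the (rational) centre coordinates,
`half k` is an integer with `e_k ≤ half k / 2^48`. [folklore] -/
structure CBox where
  /-- enclosures of the centre coordinates `c_0 … c_5` -/
  centre : List FI
  /-- scaled upper bounds of the half-widths -/
  half : List ℕ

/-- A linear constraint `Σ_k l_k (t_k − c_k) ≥ r` known to hold on the region of interest, with its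
non-negative multiplier `μ`. [folklore] -/
structure CCons where
  /-- coefficients `l_0 … l_5` -/
  l : List ℚ
  /-- right-hand side -/
  r : ℚ
  /-- multiplier (meant to be `≥ 0`) -/
  μ : ℚ

/-! ### Per-row and per-term evaluation -/

/-- `ℓ_r(c)`: the row at the centre. [folklore] -/
def rowCentre (B : CBox) (R : CRow) : FI :=
  R.coef.foldr (fun p acc => FI.add (FI.mul p.2 (getFI B.centre p.1)) acc) R.const

/-- Scaled upper bound `ρ_r · 2^48 ≤ ·` of the deviation `Σ_k |α_k| e_k` of the row over the box. [folklore] -/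
def rowDev (B : CBox) (R : CRow) : ℕ :=
  R.coef.foldr (fun p acc => (FI.absHi p.2).toNat * B.half.getD p.1 0 / SC + 1 + acc) 0

/-- The range of the row over the box: `ℓ_r(c) ± ρ_r`. [folklore] -/
def rowRange (B : CBox) (R : CRow) : FI :=
  let L := rowCentre B R
  let ρ : ℤ := rowDev B R
  ⟨L.lo - ρ, L.hi + ρ⟩

/-- Accumulate `2 κ_r α_{rk} · L` into the gradient slots `k` (`L = ℓ_r(c)` for the centre gradient,
`L = ` the row range for the box gradient). [folklore] -/
def rowGradInto (R : CRow) (L : FI) (g : List FI) : List FI :=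
  R.coef.foldr (fun p acc => addAt acc p.1 (fiScale (FI.mul p.2 L) (2 * R.κ))) g

/-- Accumulate the constant Hessian `2 κ_r α_{rk} α_{rl}` of `κ_r ℓ_r²` into the flat `6 × 6` list `H`
(entry `6k + l`). [folklore] -/
def rowHessInto (R : CRow) (H : List FI) : List FI :=
  R.coef.foldr (fun p acc =>
    R.coef.foldr (fun p' acc' => addAt acc' (6 * p.1 + p'.1) (fiScale (FI.mul p.2 p'.2) (2 * R.κ))) acc) H

/-- The accumulated state of the kernel: enclosures of `G(c)`, of `∇G(c)` (6 entries), of the matrices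
`M`, `N` (36 entries each, uniformly over the box), and a validity flag. [folklore] -/
structure KState where
  /-- encloses `Σ_i w_i φ(q_i(c))` -/
  val : FI
  /-- entry `k` encloses `Σ_i w_i φ'(q_i(c)) ∂_k q_i(c)` -/
  grad : List FI
  /-- entry `6k+l` encloses `Σ_i m_i ∂_k q_i(ξ) ∂_l q_i(ξ)` for every `ξ` in the box (`m_i ≥ (w_i φ''|_box)₋`) -/
  mm : List FI
  /-- entry `6k+l` encloses `Σ_i n_i ∂²_{kl} q_i` (`n_i ≥ (w_i φ'(q_i(c)))₋`) -/
  nn : List FI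
  /-- all terms so far had a provably positive squared distance on the box -/
  ok : Bool

/-- The initial (empty-sum) state. [folklore] -/
def KState.init : KState := ⟨fiZero, zeros 6, zeros 36, zeros 36, true⟩

/-- One row of the outer-product accumulation: `acc_{6k+l} += p · Q_l` for `l < n`. [folklore] -/
def addRow (p : FI) (Q : List FI) (k : ℕ) : ℕ → List FI → List FI
  | 0, acc => acc
  | l + 1, acc => addRow p Q k l (addAt acc (6 * k + l) (FI.mul p (getFI Q l)))

/-- Outer-product accumulation `acc_{6k+l} += P_k · Q_l` for `k < n`, `l < 6`. [folklore] -/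
def outerInto (P Q : List FI) : ℕ → List FI → List FI
  | 0, acc => acc
  | k + 1, acc => outerInto P Q k (addRow (getFI P k) Q k 6 acc)

/-- Entrywise `acc_j += c · H_j` for `j < n`. [folklore] -/
def scaleAddInto (c : FI) (H : List FI) : ℕ → List FI → List FI
  | 0, acc => acc
  | j + 1, acc => scaleAddInto c H j (addAt acc j (FI.mul c (getFI H j)))

/-- `q(c)`: the quadratic form at the centre. [folklore] -/
def termQC (B : CBox) (T : CTerm) : FI :=
  T.rows.foldr (fun R acc => FI.add (fiScale (FI.mul (rowCentre B R) (rowCentre B R)) R.κ) acc) fiZero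

/-- The range of `q` over the box. [folklore] -/
def termQB (B : CBox) (T : CTerm) : FI :=
  T.rows.foldr (fun R acc => FI.add (fiScale (fiSqr (rowRange B R)) R.κ) acc) fiZero

/-- `∇q(c)` (6 entries). [folklore] -/
def termGC (B : CBox) (T : CTerm) : List FI :=
  T.rows.foldr (fun R acc => rowGradInto R (rowCentre B R) acc) (zeros 6)

/-- The range of `∇q` over the box (6 entries). [folklore] -/
def termGB (B : CBox) (T : CTerm) : List FI :=
  T.rows.foldr (fun R acc => rowGradInto R (rowRange B R) acc) (zeros 6)

/-- The constant Hessian `∇²q` (36 entries). [folklore] -/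
def termH (T : CTerm) : List FI := T.rows.foldr rowHessInto (zeros 36)

/-- `φ = u⁶/12 − u³/6` at an enclosure `U` of `u = 1/q`. [folklore] -/
def phiC (U : FI) : FI :=
  let U3 := FI.mul (FI.mul U U) U
  FI.sub (FI.divNat (FI.mul U3 U3) 12) (FI.divNat U3 6)

/-- `φ' = (u⁴ − u⁷)/2` at an enclosure `U` of `u = 1/q`. [folklore] -/
def phi1C (U : FI) : FI :=
  let U3 := FI.mul (FI.mul U U) U
  let U6 := FI.mul U3 U3
  FI.divNat (FI.sub (FI.mul U3 U) (FI.mul U6 U)) 2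

/-- The range of `φ'' = (7/2) u⁸ − 2 u⁵` from the two ends of an enclosure `UB` of `u = 1/q` over the box
(termwise monotone: `φ'' ≥ (7/2) u_lo⁸ − 2 u_hi⁵`, `φ'' ≤ (7/2) u_hi⁸ − 2 u_lo⁵`, `u_lo` clamped at `0`). [folklore] -/
def phi2Range (UB : FI) : FI :=
  let ulo : FI := ⟨max UB.lo 0, max UB.lo 0⟩
  let uhi := fiHiPt UB
  ⟨(FI.sub (fiScale (fiPow ulo 8) (7 / 2)) (FI.mulInt (fiPow uhi 5) 2)).lo,
    (FI.sub (fiScale (fiPow uhi 8) (7 / 2)) (FI.mulInt (fiPow ulo 5) 2)).hi⟩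

/-- **Process one term**: enclose `q` at the centre and over the box, `φ(q(c))`, `φ'(q(c))`, the box range of
`φ''`, the negative parts `m = (w φ''|_box)₋`, `n = (w φ'(q(c)))₋` (as scaled integers), and accumulate value,
gradient and the two remainder matrices. [folklore] -/
def stepTerm (B : CBox) (S : KState) (T : CTerm) : KState :=
  let QB := termQB B T
  if QB.lo ≤ 0 then { S with ok := false } else
  match FI.divPos (FI.ofInt 1) (termQC B T), FI.divPos (FI.ofInt 1) QB with
  | some U, some UB =>
    let WPHI1 := fiScale (phi1C U) T.w
    let W2 := fiScale (phi2Range UB) T.w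
    let m : ℤ := max (-W2.lo) 0
    let n : ℤ := max (-WPHI1.lo) 0
    let GB := termGB B T
    { val := FI.add S.val (fiScale (phiC U) T.w)
      grad := List.zipWith FI.add S.grad ((termGC B T).map (FI.mul WPHI1))
      mm := outerInto (GB.map (FI.mul ⟨m, m⟩)) GB 6 S.mm
      nn := scaleAddInto ⟨n, n⟩ (termH T) 36 S.nn
      ok := S.ok }
  | _, _ => { S with ok := false }

/-- Process a list of terms. [folklore] -/
def runTerms (B : CBox) (ts : List CTerm) : KState := ts.foldl (stepTerm B) KState.init

/-! ### The final bound -/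

/-- One entry `half_k half_l (|M_{kl}| + |N_{kl}|)` of the remainder (scale `2^144`). [folklore] -/
def remEntry (B : CBox) (S : KState) (k l : ℕ) : ℕ :=
  B.half.getD k 0 * B.half.getD l 0 *
    ((FI.absHi (getFI S.mm (6 * k + l))).toNat + (FI.absHi (getFI S.nn (6 * k + l))).toNat)

/-- `Σ_{k < 6, l < 6}` of the remainder entries (scale `2^144`). [folklore] -/
def remSum (B : CBox) (S : KState) : ℕ :=
  ∑ k ∈ Finset.range 6, ∑ l ∈ Finset.range 6, remEntry B S k l

/-- Scaled remainder `P · 2^48 ≤ ·`: `½ Σ_{k,l} e_k e_l (|M_{kl}| + |N_{kl}|)`, rounded up. [folklore] -/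
def remainder (B : CBox) (S : KState) : ℕ :=
  ((remSum B S / SC + 1) / SC + 1) / 2 + 1

/-- `(μ ℓ)_k · 2^48` summed over the constraints, as a rational. [folklore] -/
def muEll (cons : List CCons) (k : ℕ) : ℚ := (cons.map fun C => C.μ * C.l.getD k 0).sum

/-- Scaled lower bound `· ≤ (min over the constrained box of ∇G(c)·(t − c)) · 2^48`:
`Σ_j μ_j r_j − Σ_k max(|g_k^{lo} − (μℓ)_k|, |g_k^{hi} − (μℓ)_k|) e_k`, rounded down. [folklore] -/
def linLower (B : CBox) (S : KState) (cons : List CCons) : ℤ :=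
  let gain : ℚ := (cons.map fun C => C.μ * C.r).sum
  let loss : ℚ := ∑ k ∈ Finset.range 6,
    max |((getFI S.grad k).lo : ℚ) - muEll cons k * SC| |((getFI S.grad k).hi : ℚ) - muEll cons k * SC| *
      (B.half.getD k 0 : ℚ) / SC
  ⌊gain * SC - loss⌋

/-- Well-formedness of the data (what soundness needs besides the enclosures): six centre coordinates
and half-widths, non-negative `κ`'s, variable indices `< 6`, non-negative multipliers. [folklore] -/
def wellFormed (B : CBox) (ts : List CTerm) (cons : List CCons) : Bool :=
  (B.centre.length == 6) && (B.half.length == 6) &&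
  ts.all (fun T => T.rows.all fun R => decide (0 ≤ R.κ) && R.coef.all fun p => decide (p.1 < 6)) &&
  cons.all (fun C => decide (0 ≤ C.μ))

/-- **The kernel**: a scaled lower bound `L` (meaning `L / 2^48`) of `G` on the part of the box where the
constraints hold, or `none` if some squared distance could not be separated from `0`. [folklore] -/
def lowerBound (B : CBox) (ts : List CTerm) (cons : List CCons) : Option ℤ :=
  let S := runTerms B ts
  if wellFormed B ts cons && S.ok then
    some (S.val.lo + linLower B S cons - remainder B S)
  else none

/-! ## Part B. The term tables -/


open Literature.Analysis.ValidatedNumerics.Numerics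

/-- `√3 ∈ [487528960722122, 487528960722123] / 2^48`. [folklore] -/
def SQRT3 : FI := ⟨487528960722122, 487528960722123⟩

/-- `√6 ∈ [689470068302885, 689470068302886] / 2^48`. [folklore] -/
def SQRT6 : FI := ⟨689470068302885, 689470068302886⟩

/-- Template coordinate `X = i + j/2 + δ/2`. [folklore] -/
def coordX (i j δ : ℤ) : ℚ := (i : ℚ) + (j : ℚ) / 2 + (δ : ℚ) / 2

/-- `Y / √3 = (j + δ/3)/2`. [folklore] -/
def coordYh (j δ : ℤ) : ℚ := ((j : ℚ) + (δ : ℚ) / 3) / 2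

/-- `Z / √6 = s/3`. [folklore] -/
def coordZh (s : ℤ) : ℚ := (s : ℚ) / 3

/-- The planar form `Q_δ(i,j) = X² + Y² = (i + j/2 + δ/2)² + ¾ (j + δ/3)²` (rational). [folklore] -/
def planarQ (i j δ : ℤ) : ℚ := coordX i j δ ^ 2 + 3 / 4 * ((j : ℚ) + (δ : ℚ) / 3) ^ 2

/-- The squared norm `|p|² = Q_δ(i,j) + 2s²/3` of the unit-template layer vector (rational). [folklore] -/
def normSq (i j δ s : ℤ) : ℚ := planarQ i j δ + 2 * (s : ℚ) ^ 2 / 3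

/-- **Deformed term** `w · φ(q_t(p))` of the point `(i, j)` of layer `(δ, s)`. [folklore] -/
def dTerm (i j δ s : ℤ) (w : ℚ) : CTerm :=
  let XI := fiOfRat (coordX i j δ)
  let YI := fiScale SQRT3 (coordYh j δ)
  let ZI := fiScale SQRT6 (coordZh s)
  ⟨w, [⟨1, [(0, XI), (1, YI), (2, ZI)], fiZero⟩, ⟨1, [(3, YI), (4, ZI)], fiZero⟩, ⟨1, [(5, ZI)], fiZero⟩]⟩

/-- The three clip cases of the in-plane cell parameter `a`. [folklore] -/
inductive ACase
  /-- `a = 47/50` -/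
  | lo
  /-- `a = (t₀₀ + t₁₁)/2` -/
  | mid
  /-- `a = 1` -/
  | hi
  deriving DecidableEq, Repr

/-- The three clip cases of the layer spacing `h`. [folklore] -/
inductive HCase
  /-- `h = 39 a / 50` -/
  | lo
  /-- `h = (√6/3) t₂₂` -/
  | mid
  /-- `h = 17 a / 20` -/
  | hi
  deriving DecidableEq, Repr

/-- The affine row `κ · a(t)²` of a reference term in the given case. [folklore] -/
def aRow (κ : ℚ) : ACase → CRow
  | .lo => ⟨κ, [], fiOfRat (47 / 50)⟩
  | .mid => ⟨κ, [(0, fiOfRat (1 / 2)), (3, fiOfRat (1 / 2))], fiZero⟩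
  | .hi => ⟨κ, [], fiOfRat 1⟩

/-- **Reference term** `−w · φ(a(t)² Q_δ(i,j) + s² h(t)²)` of the point `(i, j)` of layer `(δ, s)` in the clip case
`(ac, hc)`. [folklore] -/
def rTerm (i j δ s : ℤ) (w : ℚ) (ac : ACase) (hc : HCase) : CTerm :=
  let rows : List CRow :=
    if s = 0 then [aRow (planarQ i j δ) ac] else
    match hc with
    | .lo => [aRow (planarQ i j δ) ac, aRow ((s : ℚ) ^ 2 * (39 / 50) ^ 2) ac]
    | .mid => [aRow (planarQ i j δ) ac, ⟨2 * (s : ℚ) ^ 2 / 3, [(5, fiOfRat 1)], fiZero⟩]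
    | .hi => [aRow (planarQ i j δ) ac, aRow ((s : ℚ) ^ 2 * (17 / 20) ^ 2) ac]
  ⟨-w, rows⟩

/-- The integer range `[-n, n]`. [folklore] -/
def zrange (n : ℕ) : List ℤ := (List.range (2 * n + 1)).map fun a => (a : ℤ) - n

/-- **The points of layer `(δ, s)` in the template ball** `|p|² < R2` (optionally punctured at the origin),
as a list of index pairs; `n` bounds `|i|, |j|` (any `n ≥ 2√R2 + 1` enumerates them all). [folklore] -/
def layerPts (δ s : ℤ) (R2 : ℚ) (n : ℕ) (punct : Bool) : List (ℤ × ℤ) :=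
  (zrange n).flatMap fun i => ((zrange n).filter fun j =>
    decide (normSq i j δ s < R2) && !(punct && i == 0 && j == 0)).map fun j => (i, j)

/-- The deformed terms of layer `(δ, s)` with weight `w`. [folklore] -/
def dGroup (pts : List (ℤ × ℤ)) (δ s : ℤ) (w : ℚ) : List CTerm := pts.map fun p => dTerm p.1 p.2 δ s w

/-- The reference terms of layer `(δ, s)` with weight `w` (the term weight is `−w`) in the case `(ac, hc)`. [folklore] -/
def rGroup (pts : List (ℤ × ℤ)) (δ s : ℤ) (w : ℚ) (ac : ACase) (hc : HCase) : List CTerm :=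
  pts.map fun p => rTerm p.1 p.2 δ s w ac hc

end Far

end Summit.AtomisticToContinuum.Crystallization.Theorems.NashClassCertificatesNashNearField
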